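import Summits.QuantumFields.BalabanUV.T4Continuum.Support.RegionGaugeSliceTorus
import Summits.QuantumFields.BalabanUV.T4Continuum.Support.DirichletFreeTowerTop

/-!
# T⁴ programme, spine node NE2 (U1a), sub-row Δ1 «NE2⁰-Dirichlet» — THE FAITHFUL REGION VECTOR OPERATOR OF THE WHOLE TORUS **IS**
# B5's `Δ_a = Δ − ∂P∂* + aQ*Q`: `regionDeltaA n M a a′ ⊤ = (DeltaA n M a)|_{⊤}`, hence `Δ_a(⊤) ≥ γ_D`, `G(⊤) = 𝒢|_{⊤}`, `‖G(⊤)‖ ≤ Cst`,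
# and the gradient-form bound with a level-INDEPENDENT constant

NE2 formalisation swarm `b2b-balaban-t4-ne2-formalise-*`, leaf 07 (gen 6), supplier item «Δ1-COERC» (owner ruling R23 (a)), file 6.  File 5
(`Support/RegionGaugeSliceTorus`) proved the ⊤-witness of the slice inequality from «on Bałaban's slice of the whole torus B5's co-projection
`P` FIXES the divergence».  THIS FILE completes the picture asked for by the owner's located delta G-ne2p1-g12-1 («the region co-projection
`gaugeP (GOm) (QOm)` vs the torus `PcT` … the two coincide iff the region is the whole torus», `Support/RegionGaugeFixedVector` docstring) in
its «if» direction, as a kernel identity of OPERATORS: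

 * §1 two more torus lemmas on B5's objects ([Balaban1984PropagatorsI] Sect. C p. 22, tree `B5Substitution125`/`B5LaplaceInverse`/`B5Value126`
   BY NAME): `K⁻¹` fixes constants (`Minv_const`), and **`PcT_mulVec_LapS_eq_zero`**: `Q′h = 0 ⟹ P(Δh) = 0` — `P` KILLS the Laplacian of every
   scalar with zero block averages (the range «R = Δ N(Q′)» of [Balaban1985BackgroundPropagators] (3.21)).
 * §2 **`ext_gaugeR_top`**: ON MEAN-ZERO SCALARS OF THE WHOLE TORUS `R(⊤) = 1 − P` — `ι(R f) = ιf − P(ιf)` (`gaugeR_top_potential`: `R f = Δ(ιh)`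
   with `h = G′(⊤)·R f`, `Q′h = 0`; so `P` kills `ι(Rf)` (§1) and fixes `ι(f − Rf)` (file 5's `PcT_ext_eq_self_of_gaugeR_eq_zero`)).  This is
   B5 p. 30 «R = I − P … The configuration ∂*A is orthogonal to constant functions and on such configurations the operator P is given by the
   formula P = Δ⁻¹Q′*(Q′Δ⁻²Q′*)⁻¹Q′Δ⁻¹» (1.70) identified with [B9] (3.25)'s `R = I − G′Q′*(Q′G′²Q′*)⁻¹Q′G′` at `Ω₀ = ` the torus, `U = 1`.
 * §3 **`regionDeltaA_top_mulVec`** / **`regionDeltaA_top_eq_toBlock`**: `regionDeltaA n M a a′ ⊤ = (DeltaA n M a).toBlock (starReg ⊤) (starReg ⊤)`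
   (Wilson part by gen 5's `curlR_conjTranspose_mul_curlR`, gauge part by §2 on the divergence, mass part `a n^d QᴴQ = aQ*Q`), `= calDa|`
   (`B5DeltaA169.calDa_eq_DeltaA`); COROLLARIES with B5's constants, uniformly in `n = η⁻¹`, `M`: **`coercive_regionDeltaA_top_sharp`**
   `Coercive (regionDeltaA n M a a′ ⊤) (gamD d a)` (the FULL `γ_D`, improving file 5's `min(γ_D/2, γ′/2)`), **`inv_regionDeltaA_top_eq`**
   `G(⊤) = (Δ_a⁻¹)|` (gen 11's `inv_toBlock_of_forall`), **`opNorm_inv_regionDeltaA_top_le_sharp`** `‖G(⊤)‖ ≤ Cst d a` ((1.89)), and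
   **`nsq_fdiff_ext_le_form_top`** `‖∇_ν ιA′‖² ≤ (d+1)·Cst·Re⟨A′, Δ_a(⊤)A′⟩` — the vector layer's W2 input AT `⊤` with a LEVEL-INDEPENDENT
   constant (gen 11's `nsq_fdiff_le_form` read through the identity).

ROLE.  W1/W2 ⊤-witnesses for the owner's star-bond vector region tower O13-a (journal 2026-08-20 l.16321): at `S = ⊤` its operator `D k =
regionDeltaA (lev L k) M a a′ ⊤` IS `(calDalev k)|_{star ⊤}`, so W1 holds with `γ_D` and W2 with `Cg k = (d+1)·Cst` for every `k`.  NOTHING is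
said about `S ≠ ⊤` (there W2's constant is level-dependent and `SliceCoercive` uniformly in the region is the located OPEN estimate,
`t4/T4-EST-NE2-D1-COERC.md` §6).

HONEST FRAMING (T4-DAG p. 1).  Model level (`U = 1`, one averaging scale, finite torus, operator norm); [folklore] finite-dimensional algebra over
landed modules; `[cite:]` tags locate SHAPES / the printed sentences quoted; NOT a region estimate, NOT [B9] (3.23)–(3.27) as printed; NE2 (U1a)
NOT proved; spine 0/9 unchanged; NOT infinite volume / mass gap / Clay / summit progress.  HONEST DEPENDENCY: continuum YM on T⁴ ⇐ BetaPertH ∧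
nine spine estimates (0/9 proved); BetaPertH ⇐ (D1) ∧ (D4) ∧ CAP+tail; G-an2-4 gates asym, D1 and NE2/3/4.  No `sorry`.
-/

noncomputable section

open scoped BigOperators ComplexConjugate Matrix Matrix.Norms.L2Operator
open Finset

namespace Summit.QuantumFields.BalabanUV.T4Continuum.RegionGaugeFixedVectorTop

open Literature.MathematicalPhysics.QuantumFieldTheory.Balaban1983to89.B5Prop11Plancherel (Tor fine Cst fdiff)
open Literature.MathematicalPhysics.QuantumFieldTheory.Balaban1983to89.B5Prop11Lower (nsq nsq_nonneg star_dotProduct_self Lap)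
open Literature.MathematicalPhysics.QuantumFieldTheory.Balaban1983to89.B5Prop11Inverse (calDa)
open Literature.MathematicalPhysics.QuantumFieldTheory.Balaban1983to89.B5Action121 (LapS GradOp CurlOp)
open Literature.MathematicalPhysics.QuantumFieldTheory.Balaban1983to89.B5Block118 (QsOp QvOp)
open Literature.MathematicalPhysics.QuantumFieldTheory.Balaban1983to89.B5LaplaceInverse (LapSinv LapSinv_LapS_of_orth Pker Pker_const
  LapSinv_mul_LapS LapSinv_const)
open Literature.MathematicalPhysics.QuantumFieldTheory.Balaban1983to89.B5Substitution125 (Mop Minv Mop_mulVec Minv_Mop_of_orth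
  sum_QsOp_adjoint Kmat Kmat_isUnit Mop_const Cavg Cavg_mulVec QsOp_const QsOp_adjoint_const)
open Literature.MathematicalPhysics.QuantumFieldTheory.Balaban1983to89.B5Value126 (PcT PcT_mulVec ext_of_mulVec)
open Literature.MathematicalPhysics.QuantumFieldTheory.Balaban1983to89.B5DivOrth (sum_GradOp_adjoint sum_LapS)
open Literature.MathematicalPhysics.QuantumFieldTheory.Balaban1983to89.B5DeltaA169 (DeltaA QvAdj calDa_eq_DeltaA DeltaA_mulVec isUnit_DeltaA
  opNorm_DeltaA_inv_le)
open Summit.QuantumFields.BalabanUV.T4Continuum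
open Summit.QuantumFields.BalabanUV.T4Continuum.SubtypeCompression (Coercive ext ext_apply_of ext_apply_of_not nsq_ext toBlock_mulVec
  toBlock_conjTranspose coercive_toBlock opNorm_toBlock_le form_toBlock)
open Summit.QuantumFields.BalabanUV.T4Continuum.ScalarBlockPoincare (PiS)
open Summit.QuantumFields.BalabanUV.T4Continuum.ScalarAveragedPropagator (DeltaPs)
open Summit.QuantumFields.BalabanUV.T4Continuum.RegionGaugeProjection (gramK gaugeP gaugeR Q_mulVec_G_mulVec_gaugeR gaugeR_mul_gaugeR)
open Summit.QuantumFields.BalabanUV.T4Continuum.RegionScalarCompression (QOm GOm DOm_mul_GOm isUnit_det_gramK_region)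
open Summit.QuantumFields.BalabanUV.T4Continuum.RegionGaugeFixedVector (starReg curlR gradR avgR regionDeltaA curlR_conjTranspose_mul_curlR)
open Summit.QuantumFields.BalabanUV.T4Continuum.RegionGaugeFixedVectorFlat (avgR_mulVec)
open Summit.QuantumFields.BalabanUV.T4Continuum.RegionGaugeSliceTorus (eq_of_restrict_eq blockReg_topU starReg_topU
  ext_gradR_conjTranspose_mulVec_top PcT_ext_eq_self_of_gaugeR_eq_zero)
open Summit.QuantumFields.BalabanUV.T4Continuum.DirichletRegionTower (gamD coercive_calDa nsq_fdiff_le_form)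
open Summit.QuantumFields.BalabanUV.T4Continuum.DirichletFreeTowerTop (inv_toBlock_of_forall)
open Summit.QuantumFields.BalabanUV.Beta.GAN24.DirichletBoxCompression (DOm toBlock_mulVec')
open Summit.QuantumFields.BalabanUV.Beta.GAN24.DirichletBoxTrace (blockReg)

variable {d : ℕ}

/-! ## §1 Two more torus lemmas: `K⁻¹` and `P` on constants and on Laplacians of block-mean-zero scalars -/

section Torus

variable (n : ℕ) [NeZero n] (M : Fin d → ℕ) [hM : ∀ μ, NeZero (M μ)]

/-- `K⁻¹` fixes the constants (`K = Q′Δ⁻²Q′* + C`, `Q′Δ⁻²Q′*·const = 0`, `C·const = const`). [folklore] -/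
theorem Minv_const {c : ℂ} (hc : c ≠ 0) (b : ℂ) : Minv n M c *ᵥ (fun _ : Tor M => b) = fun _ => b := by
  have hdet := (Matrix.isUnit_iff_isUnit_det _).mp (Kmat_isUnit n M c hc)
  have hcard : (Fintype.card (Tor M) : ℂ) ≠ 0 := by exact_mod_cast Fintype.card_ne_zero
  have hK : Kmat n M c *ᵥ (fun _ : Tor M => b) = fun _ => b := by
    rw [Kmat, Matrix.add_mulVec, Mop_const, zero_add, Cavg_mulVec]
    funext y
    simp only [Finset.sum_const, Finset.card_univ, nsmul_eq_mul]
    field_simp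
  calc Minv n M c *ᵥ (fun _ : Tor M => b) = Minv n M c *ᵥ (Kmat n M c *ᵥ fun _ : Tor M => b) := by rw [hK]
    _ = fun _ => b := by rw [Minv, Matrix.mulVec_mulVec, Matrix.nonsing_inv_mul _ hdet, Matrix.one_mulVec]

/-- **KEY TORUS LEMMA 2**: B5's `P` KILLS the Laplacian of every scalar with zero block averages: `Q′h = 0 ⟹ P(Δh) = 0`
(`Δ⁻¹Δh = h − const`, `Q′(h − const) = −const`, `K⁻¹`, `Q′ᴴ` preserve constants, `Δ⁻¹const = 0`).
[cite: Balaban1984PropagatorsI, (1.70) p.30 (shape)] [folklore] -/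
theorem PcT_mulVec_LapS_eq_zero {c : ℂ} (hc : c ≠ 0) (h : Tor (fine n M) → ℂ) (hQ : QsOp n M *ᵥ h = 0) :
    PcT n M c *ᵥ (LapS (fine n M) c *ᵥ h) = 0 := by
  have h1 : LapSinv (fine n M) c *ᵥ (LapS (fine n M) c *ᵥ h) = h - Pker (fine n M) c *ᵥ h := by
    rw [Matrix.mulVec_mulVec, LapSinv_mul_LapS, Matrix.sub_mulVec, Matrix.one_mulVec]
  have hP : Pker (fine n M) c *ᵥ h = fun _ => (Pker (fine n M) c *ᵥ h) 0 := funext fun x => Pker_const (fine n M) hc h x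
  rw [PcT_mulVec, h1, Matrix.mulVec_sub, hQ, zero_sub, hP]
  simp only [Matrix.mulVec_neg, QsOp_const, Minv_const n M hc, QsOp_adjoint_const, LapSinv_const, neg_zero]

end Torus

section Top

variable (n : ℕ) [NeZero n] (M : Fin d → ℕ) [hM : ∀ μ, NeZero (M μ)] (a a' : ℝ) (S : Tor M → Prop) [DecidablePred S]

/-! ## §2 On mean-zero scalars of the whole torus `R(⊤) = 1 − P` -/

omit [NeZero n] hM [DecidablePred S] in
/-- extension by zero is additive. [folklore] -/
theorem ext_sub {m : Type*} (p : m → Prop) [DecidablePred p] (u v : {a // p a} → ℂ) : ext p (u - v) = ext p u - ext p v := by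
  funext i
  simp only [SubtypeCompression.ext, Pi.sub_apply]
  split_ifs with hi
  · rfl
  · exact (sub_zero 0).symm

/-- **THE POTENTIAL OF `R(⊤)f`**: `h = G′·R f` has ZERO block averages and `ι(R f) = Δ(ιh)` («R = Δ N(Q′)», (3.21), read on the whole
torus: `Δ′_a h = R f`, `Q′h = 0`, `Δ′_a = Δ + a′n^dQ′ᴴQ′`). [cite: Balaban1985BackgroundPropagators, (3.21) p.394 (shape)] [folklore] -/
theorem gaugeR_top_potential (ha' : 0 < a') (f : {x // blockReg n M (fun _ : Tor M => True) x} → ℂ) :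
    QsOp n M *ᵥ ext (blockReg n M (fun _ : Tor M => True)) (GOm n M a' (fun _ : Tor M => True) *ᵥ (gaugeR (GOm n M a' (fun _ : Tor M => True)) (QOm n M (fun _ : Tor M => True)) *ᵥ f)) = 0
    ∧ LapS (fine n M) (n : ℂ) *ᵥ ext (blockReg n M (fun _ : Tor M => True)) (GOm n M a' (fun _ : Tor M => True) *ᵥ (gaugeR (GOm n M a' (fun _ : Tor M => True)) (QOm n M (fun _ : Tor M => True)) *ᵥ f))
      = ext (blockReg n M (fun _ : Tor M => True)) (gaugeR (GOm n M a' (fun _ : Tor M => True)) (QOm n M (fun _ : Tor M => True)) *ᵥ f) := by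
  -- `h = G′·R f` has zero block averages and `Δ′_a h = R f`
  have hQ : QOm n M (fun _ : Tor M => True) *ᵥ (GOm n M a' (fun _ : Tor M => True) *ᵥ (gaugeR (GOm n M a' (fun _ : Tor M => True)) (QOm n M (fun _ : Tor M => True)) *ᵥ f)) = 0 :=
    Q_mulVec_G_mulVec_gaugeR _ _ (isUnit_det_gramK_region n M a' (fun _ : Tor M => True) ha') f
  have hD : DOm n M a' (blockReg n M (fun _ : Tor M => True)) *ᵥ (GOm n M a' (fun _ : Tor M => True) *ᵥ (gaugeR (GOm n M a' (fun _ : Tor M => True)) (QOm n M (fun _ : Tor M => True)) *ᵥ f))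
      = gaugeR (GOm n M a' (fun _ : Tor M => True)) (QOm n M (fun _ : Tor M => True)) *ᵥ f := by
    rw [Matrix.mulVec_mulVec, DOm_mul_GOm n M a' (fun _ : Tor M => True) ha', Matrix.one_mulVec]
  -- read on the torus: `Q′(ιh) = 0` …
  have hQ' : QsOp n M *ᵥ ext (blockReg n M (fun _ : Tor M => True)) (GOm n M a' (fun _ : Tor M => True) *ᵥ (gaugeR (GOm n M a' (fun _ : Tor M => True)) (QOm n M (fun _ : Tor M => True)) *ᵥ f)) = 0 := by
    have h2 : QOm n M (fun _ : Tor M => True) *ᵥ (GOm n M a' (fun _ : Tor M => True) *ᵥ (gaugeR (GOm n M a' (fun _ : Tor M => True)) (QOm n M (fun _ : Tor M => True)) *ᵥ f))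
        = fun y : {y // (fun _ : Tor M => True) y} => (QsOp n M *ᵥ ext (blockReg n M (fun _ : Tor M => True))
            (GOm n M a' (fun _ : Tor M => True) *ᵥ (gaugeR (GOm n M a' (fun _ : Tor M => True)) (QOm n M (fun _ : Tor M => True)) *ᵥ f))) y := by
      rw [QOm, toBlock_mulVec']
    have h3 : (fun y : {y // (fun _ : Tor M => True) y} => (QsOp n M *ᵥ ext (blockReg n M (fun _ : Tor M => True))
            (GOm n M a' (fun _ : Tor M => True) *ᵥ (gaugeR (GOm n M a' (fun _ : Tor M => True)) (QOm n M (fun _ : Tor M => True)) *ᵥ f))) y)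
        = fun y : {y // (fun _ : Tor M => True) y} => (0 : Tor M → ℂ) (y : Tor M) :=
      h2.symm.trans hQ
    exact eq_of_restrict_eq (fun _ : Tor M => True) (fun _ => trivial) h3
  refine ⟨hQ', ?_⟩
  -- … and `Δ′_a(ιh) = ι(Rf)`, whose `Π′`-part vanishes
  have hD' : DeltaPs n M a' *ᵥ ext (blockReg n M (fun _ : Tor M => True)) (GOm n M a' (fun _ : Tor M => True) *ᵥ (gaugeR (GOm n M a' (fun _ : Tor M => True)) (QOm n M (fun _ : Tor M => True)) *ᵥ f))
      = ext (blockReg n M (fun _ : Tor M => True)) (gaugeR (GOm n M a' (fun _ : Tor M => True)) (QOm n M (fun _ : Tor M => True)) *ᵥ f) := by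
    have h1 : DOm n M a' (blockReg n M (fun _ : Tor M => True)) *ᵥ (GOm n M a' (fun _ : Tor M => True) *ᵥ (gaugeR (GOm n M a' (fun _ : Tor M => True)) (QOm n M (fun _ : Tor M => True)) *ᵥ f))
        = fun x : {x // blockReg n M (fun _ : Tor M => True) x} => (DeltaPs n M a' *ᵥ ext (blockReg n M (fun _ : Tor M => True))
            (GOm n M a' (fun _ : Tor M => True) *ᵥ (gaugeR (GOm n M a' (fun _ : Tor M => True)) (QOm n M (fun _ : Tor M => True)) *ᵥ f))) x := by
      rw [DOm, toBlock_mulVec]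
    have h3 : gaugeR (GOm n M a' (fun _ : Tor M => True)) (QOm n M (fun _ : Tor M => True)) *ᵥ f
        = fun x : {x // blockReg n M (fun _ : Tor M => True) x} => ext (blockReg n M (fun _ : Tor M => True)) (gaugeR (GOm n M a' (fun _ : Tor M => True)) (QOm n M (fun _ : Tor M => True)) *ᵥ f) x :=
      funext fun x => (ext_apply_of _ _ x).symm
    exact eq_of_restrict_eq _ (blockReg_topU n M) (h1.symm.trans (hD.trans h3))
  rwa [DeltaPs, Matrix.add_mulVec, Matrix.smul_mulVec, PiS, Matrix.smul_mulVec, ← Matrix.mulVec_mulVec, hQ', Matrix.mulVec_zero,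
    smul_zero, smul_zero, add_zero] at hD'

/-- **`P` KILLS THE RANGE OF `R(⊤)`**: `P(ι(R f)) = 0` for every scalar `f` on the `⊤`-region. [cite: Balaban1984PropagatorsI, (1.70) p.30 (shape)] [folklore] -/
theorem PcT_ext_gaugeR_top (ha' : 0 < a') (f : {x // blockReg n M (fun _ : Tor M => True) x} → ℂ) :
    PcT n M (n : ℂ) *ᵥ ext (blockReg n M (fun _ : Tor M => True)) (gaugeR (GOm n M a' (fun _ : Tor M => True)) (QOm n M (fun _ : Tor M => True)) *ᵥ f) = 0 := by
  obtain ⟨hQ, hL⟩ := gaugeR_top_potential n M a' ha' f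
  rw [← hL]
  exact PcT_mulVec_LapS_eq_zero n M (by exact_mod_cast NeZero.ne n) _ hQ

/-- `ι(R f) ⊥ 1` (it is a Laplacian). [folklore] -/
theorem sum_ext_gaugeR_top (ha' : 0 < a') (f : {x // blockReg n M (fun _ : Tor M => True) x} → ℂ) :
    ∑ x, ext (blockReg n M (fun _ : Tor M => True)) (gaugeR (GOm n M a' (fun _ : Tor M => True)) (QOm n M (fun _ : Tor M => True)) *ᵥ f) x = 0 := by
  obtain ⟨_, hL⟩ := gaugeR_top_potential n M a' ha' f
  rw [← hL]
  exact sum_LapS (fine n M) (n : ℂ) _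

/-- **ON MEAN-ZERO SCALARS `R(⊤) = 1 − P`**: `ι(R f) = ιf − P(ιf)` whenever `ιf ⊥ 1` (split `f = Rf + (f − Rf)`: `P` kills `ι(Rf)` and
fixes `ι(f − Rf)`). [cite: Balaban1984PropagatorsI, (1.69)–(1.70) pp.29–30 (shape: R = I − P)] [folklore] -/
theorem ext_gaugeR_top (ha' : 0 < a') (f : {x // blockReg n M (fun _ : Tor M => True) x} → ℂ) (hf : ∑ x, ext (blockReg n M (fun _ : Tor M => True)) f x = 0) :
    ext (blockReg n M (fun _ : Tor M => True)) (gaugeR (GOm n M a' (fun _ : Tor M => True)) (QOm n M (fun _ : Tor M => True)) *ᵥ f)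
      = ext (blockReg n M (fun _ : Tor M => True)) f - PcT n M (n : ℂ) *ᵥ ext (blockReg n M (fun _ : Tor M => True)) f := by
  have hK := isUnit_det_gramK_region n M a' (fun _ : Tor M => True) ha'
  -- the slice part `f − Rf` is killed by `R` and is mean-zero, hence FIXED by `P`
  have hR0 : gaugeR (GOm n M a' (fun _ : Tor M => True)) (QOm n M (fun _ : Tor M => True)) *ᵥ (f - gaugeR (GOm n M a' (fun _ : Tor M => True)) (QOm n M (fun _ : Tor M => True)) *ᵥ f) = 0 := by
    rw [Matrix.mulVec_sub, Matrix.mulVec_mulVec, gaugeR_mul_gaugeR _ _ hK, sub_self]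
  have hsum : ∑ x, ext (blockReg n M (fun _ : Tor M => True)) (f - gaugeR (GOm n M a' (fun _ : Tor M => True)) (QOm n M (fun _ : Tor M => True)) *ᵥ f) x = 0 := by
    rw [ext_sub]
    simp only [Pi.sub_apply, Finset.sum_sub_distrib, hf, sum_ext_gaugeR_top n M a' ha' f, sub_zero]
  have hfix := PcT_ext_eq_self_of_gaugeR_eq_zero n M a' ha' _ hsum hR0
  -- the gauge part `Rf` is KILLED by `P`
  have hkill := PcT_ext_gaugeR_top n M a' ha' f
  have hsplit : ext (blockReg n M (fun _ : Tor M => True)) f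
      = ext (blockReg n M (fun _ : Tor M => True)) (gaugeR (GOm n M a' (fun _ : Tor M => True)) (QOm n M (fun _ : Tor M => True)) *ᵥ f)
        + ext (blockReg n M (fun _ : Tor M => True)) (f - gaugeR (GOm n M a' (fun _ : Tor M => True)) (QOm n M (fun _ : Tor M => True)) *ᵥ f) := by
    rw [ext_sub, add_sub_cancel]
  have hP : PcT n M (n : ℂ) *ᵥ ext (blockReg n M (fun _ : Tor M => True)) f
      = ext (blockReg n M (fun _ : Tor M => True)) (f - gaugeR (GOm n M a' (fun _ : Tor M => True)) (QOm n M (fun _ : Tor M => True)) *ᵥ f) := by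
    conv_lhs => rw [hsplit]
    rw [Matrix.mulVec_add, hkill, zero_add, hfix]
  rw [hP, ext_sub, sub_sub_cancel]

/-! ## §3 The operator identity: `Δ_a(⊤)` = B5's `Δ_a` compressed along the everywhere-true star predicate -/

omit [DecidablePred S] in
/-- the adjoint region curl acts as «apply `2^{−1/2}·Curlᴴ`, restrict» (any region). [folklore] -/
theorem curlR_conjTranspose_mulVec (w : Tor (fine n M) × (Fin d × Fin d) → ℂ) :
    (curlR n M S)ᴴ *ᵥ w = fun b : {b // starReg n M S b} =>
      ((((Real.sqrt 2)⁻¹ : ℝ) : ℂ) • ((CurlOp (fine n M) (n : ℂ))ᴴ *ᵥ w)) b := by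
  unfold curlR
  rw [Matrix.conjTranspose_smul, Matrix.conjTranspose_submatrix, Matrix.smul_mulVec, Complex.star_def, Complex.conj_ofReal]
  rfl

omit [DecidablePred S] in
/-- the adjoint region averaging acts as «apply `Qᴴ`, restrict» (any region). [folklore] -/
theorem avgR_conjTranspose_mulVec (μ : Tor M × Fin d → ℂ) :
    (avgR n M S)ᴴ *ᵥ μ = fun b : {b // starReg n M S b} => ((QvOp n M)ᴴ *ᵥ μ) b := by
  unfold avgR
  rw [Matrix.conjTranspose_submatrix]
  rfl

/-- the region gradient acts as «extend by zero, apply `∂`, restrict» (any region). [folklore] -/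
theorem gradR_mulVec (lam : {x // blockReg n M S x} → ℂ) :
    gradR n M S *ᵥ lam = fun b : {b // starReg n M S b} => (GradOp (fine n M) (n : ℂ) *ᵥ ext (blockReg n M S) lam) b := by
  rw [gradR, toBlock_mulVec']

/-- **THE FAITHFUL REGION OPERATOR OF THE WHOLE TORUS ACTS AS B5's `Δ_a` ON THE ZERO-EXTENSION**:
`Δ_a(⊤)·A′ = (Δ_a ιA′)|` — the Wilson part `(Δ − ∂∂ᴴ)`, the gauge part `∂R(⊤)∂ᴴ = ∂(1 − P)∂ᴴ` (§5: `R(⊤) = 1 − P` on the mean-zero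
divergence), the mass part `a n^d QᴴQ = aQ*Q`. [cite: Balaban1984PropagatorsI, (1.69)/(1.73) pp.29–30 (shape)] [folklore] -/
theorem regionDeltaA_top_mulVec (ha' : 0 < a') (A' : {b // starReg n M (fun _ : Tor M => True) b} → ℂ) :
    regionDeltaA n M a a' (fun _ : Tor M => True) *ᵥ A'
      = fun b : {b // starReg n M (fun _ : Tor M => True) b} => (DeltaA n M a *ᵥ ext (starReg n M (fun _ : Tor M => True)) A') b := by
  -- Wilson part
  have e1 : ((curlR n M (fun _ : Tor M => True))ᴴ * curlR n M (fun _ : Tor M => True)) *ᵥ A'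
      = fun b : {b // starReg n M (fun _ : Tor M => True) b} =>
          ((Lap n M - GradOp (fine n M) (n : ℂ) * (GradOp (fine n M) (n : ℂ))ᴴ) *ᵥ ext (starReg n M (fun _ : Tor M => True)) A') b := by
    rw [curlR_conjTranspose_mul_curlR]
    exact toBlock_mulVec _ _ _
  -- gauge part: `R(⊤)·∂ᴴA′ = (1 − P)∂ᴴιA′` read back through `∂`
  have e2 : gradR n M (fun _ : Tor M => True) *ᵥ (gaugeR (GOm n M a' (fun _ : Tor M => True)) (QOm n M (fun _ : Tor M => True)) *ᵥ ((gradR n M (fun _ : Tor M => True))ᴴ *ᵥ A'))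
      = fun b : {b // starReg n M (fun _ : Tor M => True) b} => (GradOp (fine n M) (n : ℂ) *ᵥ
          ((GradOp (fine n M) (n : ℂ))ᴴ *ᵥ ext (starReg n M (fun _ : Tor M => True)) A'
            - PcT n M (n : ℂ) *ᵥ ((GradOp (fine n M) (n : ℂ))ᴴ *ᵥ ext (starReg n M (fun _ : Tor M => True)) A'))) b := by
    have hsum : ∑ x, ext (blockReg n M (fun _ : Tor M => True)) ((gradR n M (fun _ : Tor M => True))ᴴ *ᵥ A') x = 0 := by
      rw [ext_gradR_conjTranspose_mulVec_top]; exact sum_GradOp_adjoint (fine n M) (n : ℂ) _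
    rw [gradR_mulVec, ext_gaugeR_top n M a' ha' _ hsum, ext_gradR_conjTranspose_mulVec_top]
  -- mass part
  have e3 : ((avgR n M (fun _ : Tor M => True))ᴴ * avgR n M (fun _ : Tor M => True)) *ᵥ A'
      = fun b : {b // starReg n M (fun _ : Tor M => True) b} => ((QvOp n M)ᴴ *ᵥ (QvOp n M *ᵥ ext (starReg n M (fun _ : Tor M => True)) A')) b := by
    rw [← Matrix.mulVec_mulVec, avgR_mulVec, avgR_conjTranspose_mulVec]
  rw [RegionGaugeFixedVector.regionDeltaA_eq, Matrix.add_mulVec, Matrix.add_mulVec, Matrix.smul_mulVec, e1, e3,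
    ← Matrix.mulVec_mulVec, ← Matrix.mulVec_mulVec, e2, DeltaA_mulVec]
  funext b
  simp only [Pi.add_apply, Pi.smul_apply, Pi.sub_apply, Matrix.sub_mulVec, Matrix.mulVec_sub, ← Matrix.mulVec_mulVec, smul_eq_mul]
  push_cast
  ring

/-- **THE OPERATOR IDENTITY**: `Δ_a(⊤)` IS B5's position-space `Δ_a = Δ − ∂P∂* + aQ*Q` compressed along the everywhere-true star
predicate. [cite: Balaban1984PropagatorsI, (1.69)/(1.73) pp.29–30 (shape)] [folklore] -/
theorem regionDeltaA_top_eq_toBlock (ha' : 0 < a') :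
    regionDeltaA n M a a' (fun _ : Tor M => True) = (DeltaA n M a).toBlock (starReg n M (fun _ : Tor M => True)) (starReg n M (fun _ : Tor M => True)) := by
  refine ext_of_mulVec fun A' => ?_
  rw [regionDeltaA_top_mulVec n M a a' ha', toBlock_mulVec]

/-- … equivalently B5's Fourier-block operator `calDa` compressed (`B5DeltaA169.calDa_eq_DeltaA`). [folklore] -/
theorem regionDeltaA_top_eq_toBlock_calDa (hn : 1 ≤ n) (ha : 0 < a) (ha' : 0 < a') :
    regionDeltaA n M a a' (fun _ : Tor M => True) = (calDa n hn M a ha).toBlock (starReg n M (fun _ : Tor M => True)) (starReg n M (fun _ : Tor M => True)) := by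
  rw [regionDeltaA_top_eq_toBlock n M a a' ha', calDa_eq_DeltaA n hn M a ha]

/-- **HENCE `Δ_a(⊤)` IS COERCIVE WITH THE FULL B5 CONSTANT `γ_D`** (not only `min(γ_D/2, γ′/2)`), uniformly in `n`, `M`.
[cite: Balaban1984PropagatorsI, Prop. 1.1 (1.90) p.33 (kernel version of the tree; constant ours)] [folklore] -/
theorem coercive_regionDeltaA_top_sharp (hn : 1 ≤ n) (ha : 0 < a) (ha' : 0 < a') :
    Coercive (regionDeltaA n M a a' (fun _ : Tor M => True)) (gamD d a) := by
  rw [regionDeltaA_top_eq_toBlock_calDa n M a a' hn ha ha']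
  exact coercive_toBlock _ (coercive_calDa M a ha n hn)

/-- **AND ITS INVERSE IS B5's `G = Δ_a⁻¹` COMPRESSED**: `G(⊤) = (𝒢)|` (compression along an everywhere-true predicate commutes with the
inverse — gen 11's `DirichletFreeTowerTop.inv_toBlock_of_forall`). [cite: Balaban1984PropagatorsI, (1.71) p.30 (shape)] [folklore] -/
theorem inv_regionDeltaA_top_eq (hn : 1 ≤ n) (ha : 0 < a) (ha' : 0 < a') :
    (regionDeltaA n M a a' (fun _ : Tor M => True))⁻¹ = ((DeltaA n M a)⁻¹).toBlock (starReg n M (fun _ : Tor M => True)) (starReg n M (fun _ : Tor M => True)) := by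
  rw [regionDeltaA_top_eq_toBlock n M a a' ha']
  exact inv_toBlock_of_forall _ (starReg_topU n M) ((Matrix.isUnit_iff_isUnit_det _).mp (isUnit_DeltaA n hn M a ha))

/-- **`‖G(⊤)‖ ≤ Cst(d,a)`** — B5 (1.89)'s first bound for the faithful region operator of the whole torus, uniformly in `n`, `M`.
[cite: Balaban1984PropagatorsI, Prop. 1.1 (1.89) p.33 (kernel version of the tree)] [folklore] -/
theorem opNorm_inv_regionDeltaA_top_le_sharp (hn : 1 ≤ n) (ha : 0 < a) (ha' : 0 < a') :
    ‖(regionDeltaA n M a a' (fun _ : Tor M => True))⁻¹‖ ≤ Cst d a := by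
  rw [inv_regionDeltaA_top_eq n M a a' hn ha ha']
  exact (opNorm_toBlock_le _ _ _).trans (opNorm_DeltaA_inv_le n hn M a ha)

/-- **THE GRADIENT-FORM BOUND AT `⊤`** (the vector layer's W2 input on the whole torus, level-INDEPENDENT constant): every lattice gradient of
the zero-extension is controlled by the form, `‖∇_ν ιA′‖² ≤ (d+1)·Cst·Re⟨A′, Δ_a(⊤)A′⟩`.
[cite: Balaban1984PropagatorsI, Prop. 1.1 (1.90) p.33 (kernel version of the tree)] [folklore] -/
theorem nsq_fdiff_ext_le_form_top (hn : 1 ≤ n) (ha : 0 < a) (ha' : 0 < a') (ν : Fin d) (A' : {b // starReg n M (fun _ : Tor M => True) b} → ℂ) :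
    nsq (fdiff (fine n M) (n : ℂ) ν *ᵥ ext (starReg n M (fun _ : Tor M => True)) A')
      ≤ ((d : ℝ) + 1) * Cst d a * (star A' ⬝ᵥ (regionDeltaA n M a a' (fun _ : Tor M => True) *ᵥ A')).re := by
  rw [regionDeltaA_top_eq_toBlock_calDa n M a a' hn ha ha', form_toBlock]
  exact nsq_fdiff_le_form M a ha n hn ν _

/-- the calDa form of the inverse identity. [folklore] -/
theorem inv_regionDeltaA_top_eq_calDa (hn : 1 ≤ n) (ha : 0 < a) (ha' : 0 < a') :
    (regionDeltaA n M a a' (fun _ : Tor M => True))⁻¹ = ((calDa n hn M a ha)⁻¹).toBlock (starReg n M (fun _ : Tor M => True)) (starReg n M (fun _ : Tor M => True)) := by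
  rw [inv_regionDeltaA_top_eq n M a a' hn ha ha', calDa_eq_DeltaA n hn M a ha]

end Top

end Summit.QuantumFields.BalabanUV.T4Continuum.RegionGaugeFixedVectorTop

end
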